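import Summits.FinalStateConjecture.FinalStateConjecture.Theses.StarvedNecks
import Summits.FinalStateConjecture.FinalStateConjecture.Theorems.SwallowTheDatumUniversalWitnessFamilySheetLine
import Summits.FinalStateConjecture.FinalStateConjecture.Theorems.SwallowTheDatumUniversalWitnessFamilySheetLineReduction
import Summits.FinalStateConjecture.FinalStateConjecture.Theorems.StarvedNecksHonestFixedRadiusSettlingSheetBurialRegionOne
import Summits.FinalStateConjecture.FinalStateConjecture.Theorems.StarvedNecksHonestFixedRadiusSettlingStubSheetProper
import Summits.FinalStateConjecture.FinalStateConjecture.Theorems.StarvedNecksHonestFixedRadiusSettlingStubNoFutureAccumulation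
import Summits.FinalStateConjecture.FinalStateConjecture.Theorems.StarvedNecksHonestFixedRadiusSettlingStubHonestPushforward
import HarnessLib

/-!
# Crux `StarvedNecks.HonestFixedRadiusSettling` (stmt-FinalStateConjecture-13550), line `far-field-surgery`
# (sheet burial, lead c2): THE COMPOSITION — crux ⇐ the four SwallowTheDatum atoms

`honestFixedRadiusSettling_of_sheetAtoms : FarAnnulusGluing → UniversalSocketBag → MGHDExists →
SubdataDevelopmentsEmbed → HonestFixedRadiusSettling` (route items stmt-FinalStateConjecture-15427, 15426, 9937,
10053 of route SwallowTheDatum, BY NAME; the crux BY NAME).  CONDITIONAL: it credits nothing by itself; it is the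
certificate that the crux — Christodoulou-genericity of weak cosmic censorship with an HONEST `C⁴` fixed-radius
decomposition — is swallowed by the same receding-surgery mechanism as the summit statement (Disproof v6 §8e.6
remarked it; the HONEST clauses `HonestCore ∧ HonestFar`, designed against hidden strong fields, do not close the
typed-genericity loophole).

Proof.  Through an exceptional admissible datum passes the SHEET-BURIAL family of the landed
`SwallowTheDatum.UniversalWitnessFamily.SheetLine.sheetBurial_of` (far-annulus gluing 15427 + the open-sheet bag from
the deep universal socket bag 15426 + the landed geometric stubs `stub_socketDilation` / `stub_socketTransportPatch` /
`stub_sheetBreathing`): its members are admissible and, for `c ≠ 0`, SHEET-SHIELDED.  A sheet-shielded member lies in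
`Negative.settlingSet`: an MGHD exists (9937) and in every MGHD `𝒟` region I embeds over the sheet (10053); complete
`𝓘⁺` rides along the embedding (landed lever `PhaseMixingCapture.WeakCosmicCensorshipMGHD.stub_scriTransfer` with the
region-I certificate `stub_regionOneScri`), the honest `C⁴` decomposition of region I
(`regionOneHonestDecomposition`, `…SheetBurialRegionOne.lean`) pushes forward along the embedding
(`stub_honestPushforward`) — its one absolute-closure clause guarded by `stub_farSlabNoEscape`, fed by properness of
sheet shields (`stub_sheetProper`) and no future accumulation (`stub_noFutureAccumulation`) — and the self-determined
exterior commutes with the embedding (landed `stub_exteriorTransport`).  Christodoulou codimension `1` then follows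
(`Negative.crux_iff`).

What the four atoms still owe (tree, 2026-08-16): 15427 ⇐ `∀ η, IsBump η → GluingFamilyFor η`
(`…ParametricKerrBurialEngine.lean`, parametric Mao–Oh–Tao gluing, unprinted); 15426 ⇐ the named fact
`MaoOhTao.ObstructionFreeAnnularGluing` ∧ the open `stub_bulkAt` (`…UniversalSocketBagBulkReduction.lean`); 9937 and 10053 ⇐
the named fact `choquetBruhat_geroch_exists_mghd_cauchy` (`…MGHDExists.lean`, `…SubdataDevelopmentsEmbedLocalisationHolds.lean`).
Closer note: this module imports the route file (for the crux BY NAME) and `Negative.KillShape` (honest-clause vocabulary, which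
imports the route file too); an eventual UNCONDITIONAL closer must therefore restate the chain Theses-free (re-home
`honestCoreSet`/`honestFarSet`, conclude the crux body verbatim) to avoid the gate's `_holds` import cycle.
-/

set_option linter.dupNamespace false

noncomputable section

namespace Summit.FinalStateConjecture.FinalStateConjecture.Theorems.StarvedNecks.SheetBurial

open scoped Manifold ContDiff Topology
open Set Filter Function Literature.Geometry.Lorentzian
open Summit.FinalStateConjecture.FinalStateConjecture.Theses.StarvedNecks (HonestFixedRadiusSettling)
open Summit.FinalStateConjecture.FinalStateConjecture.Theses.SwallowTheDatum
  (FarAnnulusGluing UniversalSocketBag MGHDExists SubdataDevelopmentsEmbed)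
open Summit.FinalStateConjecture.FinalStateConjecture.Theorems.HonestFixedRadiusSettling.Negative
  (settlingSet honestCoreSet honestFarSet honestDevelopments crux_iff)
open Summit.FinalStateConjecture.FinalStateConjecture.Theorems.SwallowTheDatum.UniversalWitnessFamily
open Summit.FinalStateConjecture.FinalStateConjecture.Theorems.SwallowTheDatum.UniversalWitnessFamily.SheetLine
  (sheetBurial_of socketBag_of_socketBagDeep)

/-- **Core of the transport, for the open-sheet datum as a VARIABLE `D₀`** (verbatim the landed `settles_core`, with
the honest `C⁴` decomposition of region I in place of the exhaustive `C²` one): complete `𝓘⁺` and an HONEST `C⁴`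
decomposition of the self-determined exterior of `𝒟`, from the specialisations to `Φ'` of `SubdataDevelopmentsEmbed`,
of `stub_exteriorTransport`, of the scri lever, from properness of `Φ'`, and from the landed stubs `stub_noFutureAccumulation`, `stub_honestPushforward` and the
region-I package `regionOneHonestDecomposition`.
[cite: DafermosLuk2017, Conjecture 1] [cite: Christodoulou1999, p. A24] -/
theorem settlesHonestly_core [Kerr.Facts] {X : Type} [TopologicalSpace X] [ChartedSpace E3 X] [IsManifold (𝓡 3) ∞ X]
    [T2Space X] [SecondCountableTopology X] [ConnectedSpace X]
    {D : InitialDataSet (𝓡 3) X} (𝒟 : VacuumCauchyDevelopment D)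
    {M : ℝ} (hM : 0 < M) {Φ' : Schwarzschild.isotropicExterior M → X}
    (hopen : Topology.IsOpenEmbedding Φ')
    (hfar : ∀ R' : ℝ, M / 2 ≤ R' →
      IsCompact (Φ' '' {y : Schwarzschild.isotropicExterior M | R' < ‖(y : E3)‖})ᶜ)
    (hproper : ∀ K : Set X, IsCompact K →
      ∃ R' : ℝ, ∀ y : Schwarzschild.isotropicExterior M, R' < ‖(y : E3)‖ → Φ' y ∉ K)
    {D₀ : InitialDataSet (𝓡 3) (Schwarzschild.isotropicExterior M)}
    (hdata : D₀ = Schwarzschild.timeSymmetricExteriorData M hM.le)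
    (hEspec : ∀ 𝒟' : VacuumCauchyDevelopment D₀, ∃ χ : 𝒟'.carrier → 𝒟.carrier,
      ContMDiff (𝓡 4) (𝓡 4) ∞ χ ∧ Topology.IsOpenEmbedding χ ∧
        𝒟'.metric.IsIsometricImmersion 𝒟.metric.toPseudoRiemannianMetric χ ∧
          𝒟'.timeOrientation.PreservesTimeOrientation χ 𝒟.timeOrientation ∧
            χ ∘ 𝒟'.embed = 𝒟.embed ∘ Φ')
    (hT1spec : ∀ (𝒦 : CauchyDevelopment D₀) (χ : 𝒦.carrier → 𝒟.carrier),
      ContMDiff (𝓡 4) (𝓡 4) ∞ χ → Topology.IsOpenEmbedding χ →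
      𝒦.metric.IsIsometricImmersion 𝒟.metric.toPseudoRiemannianMetric χ →
      𝒦.timeOrientation.PreservesTimeOrientation χ 𝒟.timeOrientation →
      χ ∘ 𝒦.embed = 𝒟.embed ∘ Φ' →
      ∀ C : Set 𝒦.carrier,
        Summit.FinalStateConjecture.exteriorOf 𝒟.toCauchyDevelopment (χ '' C) =
          χ '' Summit.FinalStateConjecture.exteriorOf 𝒦 C)
    (hSTspec : ∀ (𝒮 : DataEmbedding D₀) (χ : 𝒮.carrier → 𝒟.carrier),
      ContMDiff (𝓡 4) (𝓡 4) ∞ χ → Topology.IsOpenEmbedding χ →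
      𝒮.metric.IsIsometricImmersion 𝒟.metric.toPseudoRiemannianMetric χ →
      𝒮.timeOrientation.PreservesTimeOrientation χ 𝒟.timeOrientation →
      χ ∘ 𝒮.embed = 𝒟.embed ∘ Φ' →
      ∀ (K : Set X), IsCompact K → Kᶜ ⊆ Set.range Φ' →
      (∀ [𝒮.metric.HasLeviCivita],
        ∃ K₀ : Set X, IsCompact K₀ ∧ ∀ s : ℝ, 0 < s → ∃ K₁ : Set X, IsCompact K₁ ∧
          ∀ p : Schwarzschild.isotropicExterior M, Φ' p ∉ K₁ → ∀ (γ : ℝ → 𝒮.carrier) (dom : Set ℝ),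
            𝒮.metric.IsNormalisedNullRayFrom 𝒮.timeOrientation 𝒮.embed 𝒮.normal p γ dom →
            ¬ BddAbove dom ∨ ENNReal.ofReal s ≤ sojournTime γ dom
              (𝒮.metric.causalFuture 𝒮.timeOrientation (𝒮.embed '' (Φ' ⁻¹' K₀)))) →
      Summit.FinalStateConjecture.HasCompleteNullInfinity 𝒟.toCauchyDevelopment) :
    Summit.FinalStateConjecture.HasCompleteNullInfinity 𝒟.toCauchyDevelopment ∧
      ∃ (O : Set 𝒟.carrier) (dec : FinalStateDecomposition 𝒟.toSpacetime O 4) (R₀ : ℝ),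
        O = Summit.FinalStateConjecture.exteriorOf 𝒟.toCauchyDevelopment dec.charted ∧
          dec ∈ honestCoreSet 𝒟.toSpacetime O 4 R₀ ∧ dec ∈ honestFarSet 𝒟.toSpacetime O 4 R₀ := by
  subst hdata
  -- the explicit region-I development of the open-sheet datum (verbatim `settles_core`)
  let ψ : Schwarzschild.isotropicExterior M → Kerr.region 0 (Kerr.rPlus M 0) := fun y ↦
    ⟨E4.ofTimeSpace (2 * M * Real.log (‖(y : E3)‖ * (1 + M / (2 * ‖(y : E3)‖)) ^ 2 / (2 * M) - 1))
        ((1 + M / (2 * ‖(y : E3)‖)) ^ 2 • (y : E3)),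
      ThroatSettlesToo.sheetPoint_mem hM y⟩
  let ν : NormalField 𝓘(ℝ, E4) ψ := fun y ↦
    (Real.sqrt (1 - 2 * M / (‖(y : E3)‖ * (1 + M / (2 * ‖(y : E3)‖)) ^ 2)))⁻¹ • E4.basisVector 0
  have hψ : ∀ y, (ψ y : E4) =
      E4.ofTimeSpace (2 * M * Real.log (‖(y : E3)‖ * (1 + M / (2 * ‖(y : E3)‖)) ^ 2 / (2 * M) - 1))
        ((1 + M / (2 * ‖(y : E3)‖)) ^ 2 • (y : E3)) := fun y ↦ rfl
  have hν : ∀ y, ν y = (Real.sqrt (1 - 2 * M / (‖(y : E3)‖ * (1 + M / (2 * ‖(y : E3)‖)) ^ 2)))⁻¹ •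
      E4.basisVector 0 := fun y ↦ rfl
  obtain ⟨hemb, hunit, hh, hk⟩ := stub_sheetDataEmbedding M hM ψ ν hψ hν
  have hcauchy := stub_sheetCauchy M hM ψ hψ
  let 𝒦₀ : VacuumCauchyDevelopment (Schwarzschild.timeSymmetricExteriorData M hM.le) :=
    { toSpacetime := Kerr.spacetime M 0 (Kerr.rPlus M 0) hM.le
      embed := ψ
      isSmoothEmbedding := hemb
      normal := ν
      isFutureUnitNormal := hunit
      induced_h := hh
      induced_k := by
        intro inst y
        haveI : (Kerr.smoothMetric M 0 (Kerr.rPlus M 0)).toPseudoRiemannianMetric.HasLeviCivita := inst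
        exact hk y
      isCauchyHypersurface := hcauchy
      isRicciFlat := by
        intro inst
        haveI : (Kerr.smoothMetric M 0 (Kerr.rPlus M 0)).toPseudoRiemannianMetric.HasLeviCivita := inst
        exact Kerr.isRicciFlat_smoothMetric_zero_spin M (Kerr.rPlus M 0) }
  -- exterior ignorance: 𝒦₀ embeds into 𝒟 over Φ'
  obtain ⟨χ, hχ, hχo, hiso, hτ, hcomm⟩ := hEspec 𝒦₀
  refine ⟨?_, ?_⟩
  · -- scri: the relative certificate of region I rides along χ (landed lever), verbatim `settles_core`
    refine hSTspec 𝒦₀.toDataEmbedding χ hχ hχo hiso hτ hcomm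
      (Φ' '' {y : Schwarzschild.isotropicExterior M | M / 2 + 1 < ‖(y : E3)‖})ᶜ
      (hfar (M / 2 + 1) (by linarith)) (fun x hx ↦ ?_) ?_
    · simp only [Set.mem_compl_iff, not_not] at hx
      obtain ⟨y, -, rfl⟩ := hx
      exact ⟨y, rfl⟩
    · intro _inst
      haveI : (Kerr.smoothMetric M 0 (Kerr.rPlus M 0)).toPseudoRiemannianMetric.HasLeviCivita := _inst
      obtain ⟨R₀, hR₀, hs⟩ := stub_regionOneScri M hM ψ ν hψ hν
      set A₀ : Set (Schwarzschild.isotropicExterior M) :=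
        {y | R₀ ≤ ‖(y : E3)‖ ∧ ‖(y : E3)‖ ≤ R₀ + 1} with hA₀
      have hA₀c : IsCompact A₀ := by
        rw [Subtype.isCompact_iff]
        have hS : (Subtype.val '' A₀ : Set E3) = {z : E3 | R₀ ≤ ‖z‖ ∧ ‖z‖ ≤ R₀ + 1} := by
          ext z
          simp only [Set.mem_image, Set.mem_setOf_eq, hA₀]
          constructor
          · rintro ⟨y, hy, rfl⟩
            exact hy
          · intro hz
            have hzM : M / 2 < ‖z‖ := lt_of_lt_of_le hR₀ hz.1
            exact ⟨⟨z, hzM⟩, hz, rfl⟩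
        rw [hS]
        have hsub : {z : E3 | R₀ ≤ ‖z‖ ∧ ‖z‖ ≤ R₀ + 1} ⊆ Metric.closedBall (0 : E3) (R₀ + 1) := by
          intro z hz
          rw [Metric.mem_closedBall, dist_zero_right]
          exact hz.2
        refine (isCompact_closedBall (0 : E3) (R₀ + 1)).of_isClosed_subset ?_ hsub
        exact (isClosed_le continuous_const continuous_norm).inter
          (isClosed_le continuous_norm continuous_const)
      refine ⟨Φ' '' A₀, hA₀c.image hopen.continuous, fun s hs0 ↦ ?_⟩
      obtain ⟨R₁, hR₁⟩ := hs s hs0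
      refine ⟨(Φ' '' {y : Schwarzschild.isotropicExterior M | max R₁ (M / 2) < ‖(y : E3)‖})ᶜ,
        hfar _ (le_max_right _ _), fun p hp γ dom hγ ↦ ?_⟩
      have hpR : R₁ < ‖(p : E3)‖ := by
        simp only [Set.mem_compl_iff, not_not] at hp
        obtain ⟨y, hy, hyp⟩ := hp
        have : y = p := hopen.injective hyp
        subst this
        exact lt_of_le_of_lt (le_max_left _ _) hy
      have hpre : Φ' ⁻¹' (Φ' '' A₀) = A₀ := hopen.injective.preimage_image A₀
      have key := hR₁ p hpR γ dom hγ
      rw [hpre]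
      exact key
  · -- decomposition: the honest region-I decomposition, pushed forward along χ
    obtain ⟨O₀, dec₀, R₀, hO₀, hc₀, hf₀, hnoesc₀⟩ := regionOneHonestDecomposition hM ψ hψ
    have hslice := image_staticSlice_subset hM hψ 𝒟.toCauchyDevelopment hcomm
    have hnoacc := stub_noFutureAccumulation M hM X D 𝒟.toCauchyDevelopment χ hχ hχo hiso hτ hslice
    have hne := hnoesc₀ X D 𝒟.toCauchyDevelopment Φ' χ hχ hχo hiso hτ hcomm hproper hnoacc
    obtain ⟨dec', hch', hc', hf'⟩ :=
      stub_honestPushforward 𝒦₀.toSpacetime 𝒟.toSpacetime χ hχ hχo hiso hτ O₀ 4 dec₀ R₀ hc₀ hf₀ hne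
    refine ⟨χ '' O₀, dec', R₀, ?_, hc', hf'⟩
    have h1 := hT1spec 𝒦₀.toCauchyDevelopment χ hχ hχo hiso hτ hcomm dec₀.charted
    rw [hch', h1]
    exact congrArg (fun S ↦ χ '' S) hO₀

/-- **Complete `𝓘⁺` and an HONEST `C⁴` decomposition in every MAXIMAL development of a sheet-shielded datum**:
`𝒟 ∈ honestDevelopments D` — from `SubdataDevelopmentsEmbed` (route item 10053) specialised to the sheet chart, the
landed levers `stub_exteriorTransport` / `stub_scriTransfer`, properness of the sheet chart (`stub_sheetProper`) and
`settlesHonestly_core`. [cite: DafermosLuk2017, Conjecture 1] -/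
theorem mem_honestDevelopments_ofSheet (hE : SubdataDevelopmentsEmbed)
    (X : Type) [TopologicalSpace X] [ChartedSpace E3 X] [IsManifold (𝓡 3) ∞ X]
    [T2Space X] [SecondCountableTopology X] [ConnectedSpace X]
    (D : InitialDataSet (𝓡 3) X)
    (hsh : ∃ (M' : ℝ) (hM' : 0 < M') (Φ : Schwarzschild.isotropicExterior M' → X)
      (hΦ : ContMDiff (𝓡 3) (𝓡 3) (∞ + 1) Φ) (hΦ' : ∀ u, Function.Injective (mfderiv (𝓡 3) (𝓡 3) Φ u)),
      Topology.IsOpenEmbedding Φ ∧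
      (∀ R' : ℝ, M' / 2 ≤ R' →
        IsCompact (Φ '' {y : Schwarzschild.isotropicExterior M' | R' < ‖(y : E3)‖})ᶜ) ∧
      D.comap Φ hΦ hΦ' = Schwarzschild.timeSymmetricExteriorData M' hM'.le)
    (𝒟 : VacuumCauchyDevelopment D) (hmax : 𝒟.IsMaximal) :
    𝒟 ∈ honestDevelopments D := by
  haveI : Kerr.Facts :=
    ⟨Kerr.isConnected_region_holds, Kerr.contMDiff_bilin_holds, Kerr.contMDiff_timeVector_holds⟩
  obtain ⟨M, hM, Φ', hΦ', hΦ'', hopen, hfar, hdata⟩ := hsh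
  have hproper := stub_sheetProper X D M hM Φ' hΦ' hΦ'' hopen hdata
  exact settlesHonestly_core 𝒟 hM hopen hfar hproper hdata
    (hE X D 𝒟 hmax (Schwarzschild.isotropicExterior M) Φ' hΦ' hΦ'' hopen)
    (stub_exteriorTransport X D 𝒟.toCauchyDevelopment (Schwarzschild.isotropicExterior M) Φ' hΦ' hΦ'' hopen)
    (Summit.FinalStateConjecture.FinalStateConjecture.Theorems.PhaseMixingCapture.WeakCosmicCensorshipMGHD.stub_scriTransfer
      X D 𝒟.toCauchyDevelopment (Schwarzschild.isotropicExterior M) Φ' hΦ' hΦ'' hopen)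

/-- **THE CRUX FROM THE FOUR SWALLOW-THE-DATUM ATOMS** (line `far-field-surgery`, reshape v6; CONDITIONAL — credits
nothing by itself).  The four EXISTING SwallowTheDatum items — `FarAnnulusGluing` (15427), `UniversalSocketBag`
(15426), `MGHDExists` (9937), `SubdataDevelopmentsEmbed` (10053), all BY NAME — imply the crux
`StarvedNecks.HonestFixedRadiusSettling` BY NAME: through an exceptional admissible `d`
passes the SHEET-BURIAL family of the landed `sheetBurial_of` (far gluing + the open-sheet bag
`socketBag_of_socketBagDeep` + the landed `stub_socketDilation` / `stub_socketTransportPatch` / `stub_sheetBreathing`);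
its members are admissible and, for `c ≠ 0`, sheet-shielded, hence in `settlingSet X` (`MGHDExists` for the ∃-MGHD
conjunct, `mem_honestDevelopments_ofSheet` for the ∀-MGHD conjunct) — Christodoulou codimension `1`
(`Negative.crux_iff`). [cite: Christodoulou1999, p. A24] [cite: DafermosLuk2017, Conjecture 1] -/
theorem honestFixedRadiusSettling_of_sheetAtoms : FarAnnulusGluing → UniversalSocketBag → MGHDExists → SubdataDevelopmentsEmbed → HonestFixedRadiusSettling := by
  intro hA hU hMGHD hE
  rw [crux_iff]
  intro X _ _ _ _ _ _ d hd
  obtain ⟨hdadm, -⟩ := hd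
  obtain ⟨F, hF, h0, hinj, hadm, hsh⟩ :=
    sheetBurial_of hA (socketBag_of_socketBagDeep hU)
      Summit.FinalStateConjecture.FinalStateConjecture.Theorems.SwallowTheDatum.UniversalWitnessFamily.stub_socketDilation
      Summit.FinalStateConjecture.FinalStateConjecture.Theorems.SwallowTheDatum.UniversalWitnessFamily.stub_socketTransportPatch
      Summit.FinalStateConjecture.FinalStateConjecture.Theorems.SwallowTheDatum.UniversalWitnessFamily.stub_sheetBreathing
      X d hdadm
  refine ⟨F, hF, h0, hinj, hadm, fun c hc hcE ↦ hcE.2 ?_⟩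
  exact ⟨hMGHD X (F c) (hadm c), fun 𝒟 h𝒟 ↦
    mem_honestDevelopments_ofSheet hE X (F c) (hsh c hc) 𝒟 h𝒟⟩


end Summit.FinalStateConjecture.FinalStateConjecture.Theorems.StarvedNecks.SheetBurial

end
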